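import Mathlib
import Literature.Analysis.OperatorTheory.ContractiveDetComplexity
import Summits.ValiantsHypothesis.ValiantsHypothesis.Theorems.ContractivityPricePriceOfContractivityStubOneLargeClassSchur
import Summits.ValiantsHypothesis.ValiantsHypothesis.Theorems.FreeFermionCLLCubicReadOnce
import HarnessLib

/-!
# ♦ for few colour classes — piece (W2) `piece3_schurExpansion`: row-multilinear expansion

Crux `PriceOfContractivity` (stmt-ValiantsHypothesis-10583), line `birth`, registered stub
`stub_stableLifting_fewColours` (skeleton rev 10), piece `piece3_schurExpansion` (W2).

For a block matrix `K = [[A, B], [C, D]]` on `Fin n ⊕ Fin t` coloured `x` on the first block and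
`c : Fin t → σ` on the second, the Sylvester pencil determinant expands multilinearly in the
foreign rows:
`det (1 + diag (X ∘ κ) K) = Σ_{S ⊆ Fin t} Ê_S · ∏_{i ∈ S} X_{c i}`,
`E_S(ξ) = det [[1 + ξA, ξB_{·S}], [C_{S·}, D_{SS}]] ∈ ℂ[ξ]` the bordered determinant and
`^` the substitution `ξ ↦ X_x`.

Proof (pointwise, then polynomial).  At a point `z` with `a(ξ) := det (1 + ξA) ≠ 0` (`ξ = z_x`)
the pencil determinant is `a(ξ) · det (1 + diag (z ∘ c) M(ξ))` with the Schur complement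
`M(ξ) = D − ξ C (1 + ξA)⁻¹ B` (`schur_eval_pencil_fromBlocks`); the principal-minor expansion
`det (1 + diag (y) M) = Σ_S (∏_{i ∈ S} y_i) det M_{SS}` (`det_one_add_diagonal_mul_eq_sum_minors`)
and `E_S(ξ) = a(ξ) · det M(ξ)_{SS}` (Schur complement of the bordered matrix) give the identity at
all such `z`; since `a(0) = 1 ≠ 0` the two polynomials agree (`schur_eq_of_eval_eq`).  All folklore.
-/

noncomputable section

-- `Summit.<Summit>.<Problem>` repeats `ValiantsHypothesis` by the tree's layout convention (D-0017).
set_option linter.dupNamespace false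

namespace Summit.ValiantsHypothesis.ValiantsHypothesis.Theorems.PriceOfContractivity.FewColours

open Matrix
open Summit.ValiantsHypothesis.ValiantsHypothesis.Theorems.PriceOfContractivity.OneLargeClass
  (schur_eval_pencil_fromBlocks schur_eval_det_one_add_X_smul schur_eval_aeval_X
    schur_eq_of_eval_eq)
open Summit.ValiantsHypothesis.ValiantsHypothesis.Theorems.FreeFermionCLLCubicReadOnce
  (det_one_add_diagonal_mul_eq_sum_minors)

/-! ### The bordered determinant at a point, general index map -/

/-- `E_w(ξ) = a(ξ) · det (M(ξ)_ww)` when `a(ξ) = det (1 + ξA) ≠ 0`, for the bordered determinant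
`E_w = det [[1 + ξA, ξB_w], [C_w, D_ww]] ∈ ℂ[ξ]` indexed by an arbitrary map `w : o → Fin t`
(Schur complement of the `(1 + ξA)`-block). [folklore] -/
theorem eval_bordPoly_of_map {n t : ℕ} {o : Type*} [Fintype o] [DecidableEq o]
    (A : Matrix (Fin n) (Fin n) ℂ) (B : Matrix (Fin n) (Fin t) ℂ) (C : Matrix (Fin t) (Fin n) ℂ)
    (D : Matrix (Fin t) (Fin t) ℂ) (w : o → Fin t) (ξ : ℂ) (hA : (1 + ξ • A).det ≠ 0) :
    (Matrix.fromBlocks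
        ((1 : Matrix (Fin n) (Fin n) (Polynomial ℂ)) +
          (Polynomial.X : Polynomial ℂ) • A.map (fun a : ℂ => Polynomial.C a))
        ((Polynomial.X : Polynomial ℂ) • (B.submatrix id w).map (fun a : ℂ => Polynomial.C a))
        ((C.submatrix w id).map (fun a : ℂ => Polynomial.C a))
        ((D.submatrix w w).map (fun a : ℂ => Polynomial.C a))).det.eval ξ =
      (1 + ξ • A).det * ((D - ξ • (C * (1 + ξ • A)⁻¹ * B)).submatrix w w).det := by
  -- adapted from `OneLargeClass.eval_bordPoly` (index map `Fin s → Fin t` ↦ `o → Fin t`)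
  have heval : (Matrix.fromBlocks
        ((1 : Matrix (Fin n) (Fin n) (Polynomial ℂ)) +
          (Polynomial.X : Polynomial ℂ) • A.map (fun a : ℂ => Polynomial.C a))
        ((Polynomial.X : Polynomial ℂ) • (B.submatrix id w).map (fun a : ℂ => Polynomial.C a))
        ((C.submatrix w id).map (fun a : ℂ => Polynomial.C a))
        ((D.submatrix w w).map (fun a : ℂ => Polynomial.C a))).det.eval ξ =
      (Matrix.fromBlocks (1 + ξ • A) (ξ • B.submatrix id w) (C.submatrix w id)
        (D.submatrix w w)).det := by
    rw [← Polynomial.coe_evalRingHom, RingHom.map_det, RingHom.mapMatrix_apply,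
      Matrix.fromBlocks_map]
    congr 1
    ext (i | i) (j | j)
    · rw [Matrix.fromBlocks_apply₁₁, Matrix.fromBlocks_apply₁₁, Matrix.map_apply, Matrix.add_apply,
        Matrix.add_apply, Matrix.smul_apply, Matrix.smul_apply, Matrix.map_apply, Matrix.one_apply,
        Matrix.one_apply]
      split_ifs <;> simp <;> ring
    · rw [Matrix.fromBlocks_apply₁₂, Matrix.fromBlocks_apply₁₂, Matrix.map_apply, Matrix.smul_apply,
        Matrix.smul_apply, Matrix.map_apply, Polynomial.coe_evalRingHom, smul_eq_mul, smul_eq_mul,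
        Polynomial.eval_mul, Polynomial.eval_X, Polynomial.eval_C]
    · rw [Matrix.fromBlocks_apply₂₁, Matrix.fromBlocks_apply₂₁, Matrix.map_apply, Matrix.map_apply,
        Polynomial.coe_evalRingHom, Polynomial.eval_C]
    · rw [Matrix.fromBlocks_apply₂₂, Matrix.fromBlocks_apply₂₂, Matrix.map_apply, Matrix.map_apply,
        Polynomial.coe_evalRingHom, Polynomial.eval_C]
  letI : Invertible (1 + ξ • A) := Matrix.invertibleOfIsUnitDet _ (isUnit_iff_ne_zero.mpr hA)
  rw [heval, Matrix.det_fromBlocks₁₁, Matrix.invOf_eq_nonsing_inv]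
  congr 2
  rw [Matrix.submatrix_sub, Pi.sub_apply, Pi.sub_apply, Matrix.submatrix_smul, Pi.smul_apply,
    Pi.smul_apply, Matrix.submatrix_mul _ _ w id w Function.bijective_id,
    Matrix.submatrix_mul _ _ w id id Function.bijective_id, Matrix.submatrix_id_id, Matrix.mul_smul]

/-! ### The expansion -/

/-- **Piece (W2): row-multilinear (Schur) expansion of the pencil determinant of a two-block
matrix.**  For `K = [[A, B], [C, D]]` (blocks `Fin n`, `Fin t`) coloured `x` on the first block and
`c` on the second, `det (1 + diag (X ∘ κ) K) = Σ_{S ⊆ Fin t} Ê_S · ∏_{i ∈ S} X_{c i}` with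
`E_S = det [[1 + ξA, ξB_{·S}], [C_{S·}, D_{SS}]] ∈ ℂ[ξ]` and `^` the substitution `ξ ↦ X_x`.
[folklore] -/
theorem piece3_schurExpansion :
    ∀ {σ : Type} {n t : ℕ} (x : σ) (c : Fin t → σ) (A : Matrix (Fin n) (Fin n) ℂ)
      (B : Matrix (Fin n) (Fin t) ℂ) (C : Matrix (Fin t) (Fin n) ℂ) (D : Matrix (Fin t) (Fin t) ℂ),
      (1 + Matrix.diagonal (fun i => MvPolynomial.X (Sum.elim (fun _ => x) c i)) *
          (Matrix.fromBlocks A B C D).map (fun a : ℂ => (MvPolynomial.C a : MvPolynomial σ ℂ))).det =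
        ∑ S : Finset (Fin t),
          Polynomial.aeval (MvPolynomial.X x : MvPolynomial σ ℂ)
            (Matrix.fromBlocks
              ((1 : Matrix (Fin n) (Fin n) (Polynomial ℂ)) +
                (Polynomial.X : Polynomial ℂ) • A.map (fun a : ℂ => Polynomial.C a))
              ((Polynomial.X : Polynomial ℂ) •
                (B.submatrix id (fun i : S => (i : Fin t))).map (fun a : ℂ => Polynomial.C a))
              ((C.submatrix (fun i : S => (i : Fin t)) id).map (fun a : ℂ => Polynomial.C a))
              ((D.submatrix (fun i : S => (i : Fin t)) (fun i : S => (i : Fin t))).map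
                (fun a : ℂ => Polynomial.C a))).det *
            ∏ i ∈ S, MvPolynomial.X (c i) := by
  intro σ n t x c A B C D
  set a : Polynomial ℂ := ((1 : Matrix (Fin n) (Fin n) (Polynomial ℂ)) +
    (Polynomial.X : Polynomial ℂ) • A.map (fun a : ℂ => Polynomial.C a)).det with ha
  have ha_eval : ∀ ξ : ℂ, a.eval ξ = (1 + ξ • A).det := schur_eval_det_one_add_X_smul A
  have ha0 : a.eval 0 ≠ 0 := by rw [ha_eval]; simp
  refine schur_eq_of_eval_eq x a ha0 fun z hz => ?_
  rw [ha_eval] at hz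
  rw [schur_eval_pencil_fromBlocks x c A B C D z hz, det_one_add_diagonal_mul_eq_sum_minors,
    Finset.mul_sum, map_sum]
  refine Finset.sum_congr rfl fun S _ => ?_
  rw [map_mul, schur_eval_aeval_X, eval_bordPoly_of_map A B C D _ (z x) hz, map_prod]
  simp only [MvPolynomial.eval_X]
  ring

end Summit.ValiantsHypothesis.ValiantsHypothesis.Theorems.PriceOfContractivity.FewColours
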